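import Summits.QuantumFields.YangMills.Theorems.ComplexCouplingChannelTubeZeroFreeChannelEngineAnchor
import Summits.QuantumFields.YangMills.Theorems.ComplexCouplingChannelHarmonicMeasureEngineDiscChain
import Literature.Analysis.Complex.VitaliConvergence
import Literature.Analysis.Complex.LogDerivZeros
import HarnessLib

/-!
# Engine of `TubeZeroFreeChannel`, part 2: exponential rate pinning propagates along a zero-free channel

Crux `TubeZeroFreeChannel` (item stmt-QuantumFields-18841, route `ComplexCouplingChannel`), strategist
certificate, file 2 of 3.  Pure complex analysis — the route's "harmonic-measure engine" run on logarithms: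

`exists_rate_pinning_of_zeroFree`: along a chain of discs joining the anchor point `x` to `β` inside an open
connected zero-free domain `D` of entire functions `f_t` of exponential type, holomorphic logarithms `g_t` of
`f_t` are continued disc by disc (`exists_log_on_ball`, uniqueness on the convex overlaps), the normalised
logarithms `g_t / t` converge by Vitali (`exists_tendstoLocallyUniformlyOn_of_frequently_tendsto`, local
boundedness from Borel–Carathéodory) to holomorphic rates `E^{(j)}` agreeing on overlaps, and the Hadamard
three-circles step `norm_le_sqrt_of_three_circles` propagates the anchor's exponential pinning
`‖f_t e^{−t e} − 1‖ ≤ C e^{−c₁ t}` against the sub-exponential bound `‖f_t e^{−t E^{(j)}} − 1‖ ≤ e^{ε' t} + 1`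
(uniform convergence on compacts): at `β`, `‖f_t(β) e^{−t E} − 1‖ ≤ C' e^{−(c₁ θ / 2) t}`, `θ = 2^{−N}` with `N`
the length of the chain — independent of the functions.

References: Hadamard (1896) (three circles); R. Nevanlinna, *Eindeutige analytische Funktionen* (1936) §III.2
(two-constants theorem); E. C. Titchmarsh, *The Theory of Functions* §5.21 (Vitali); Mathlib
`Complex.borelCaratheodory_zero`.
-/

set_option autoImplicit false

noncomputable section

open scoped Topology
open Filter Metric Set Complex

namespace Summit.QuantumFields.YangMills.Theorems.TubeZeroFreeChannel

set_option maxHeartbeats 1600000 in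
/-- **Rate pinning propagates along zero-free channels.** Let `D ⊆ ℂ` be open and preconnected, `x, β ∈ D`,
`r₀ > 0`. There is `θ ∈ (0, 1]` (from the chain of discs joining `x` to `β` in `D`; independent of the
functions) such that: whenever entire functions `f t` (`t ≥ t₀ ≥ 1`) are zero-free on `D`, grow at most like
`‖f t z‖ ≤ e^{t A ‖z‖}`, and admit on `ball x r₀` holomorphic logarithms `ℓ t` pinned to a holomorphic rate `e`,
`‖ℓ t − t e‖ ≤ C e^{−c₁ t}`, then at `β` the `f t` are exponentially pinned to SOME rate `E`:
`‖f t β · e^{−t E} − 1‖ ≤ C' e^{−(c₁ θ / 2) t}` for `t ≥ T`. (Disc-chain continuation of `t⁻¹ log f t`, Vitali,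
Hadamard three circles.) [folklore] -/
theorem exists_rate_pinning_of_zeroFree {D : Set ℂ} (hD : IsOpen D) (hDc : IsPreconnected D) {x β : ℂ}
    (hx : x ∈ D) (hβ : β ∈ D) {r₀ : ℝ} (hr₀ : 0 < r₀) :
    ∃ θ : ℝ, 0 < θ ∧ θ ≤ 1 ∧
      ∀ (f : ℕ → ℂ → ℂ) (ℓ : ℕ → ℂ → ℂ) (e : ℂ → ℂ) (t₀ : ℕ) (A C c₁ : ℝ),
        1 ≤ t₀ → 0 ≤ A → 0 < c₁ →
        (∀ t, Differentiable ℂ (f t)) →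
        (∀ t, t₀ ≤ t → ∀ z ∈ D, f t z ≠ 0) →
        (∀ t, t₀ ≤ t → ∀ z, ‖f t z‖ ≤ Real.exp (t * (A * ‖z‖))) →
        DifferentiableOn ℂ e (ball x r₀) →
        (∀ t, t₀ ≤ t → DifferentiableOn ℂ (ℓ t) (ball x r₀)) →
        (∀ t, t₀ ≤ t → ∀ z ∈ ball x r₀, exp (ℓ t z) = f t z) →
        (∀ t, t₀ ≤ t → ∀ z ∈ ball x r₀, ‖ℓ t z - (t : ℂ) * e z‖ ≤ C * Real.exp (-(c₁ * t))) →
        ∃ E : ℂ, ∃ C' : ℝ, ∃ T : ℕ, ∀ t : ℕ, T ≤ t →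
          ‖f t β * exp (-((t : ℂ) * E)) - 1‖ ≤ C' * Real.exp (-(c₁ * θ / 2 * t)) := by
  /- GEOMETRY (depends only on `(D, x, r₀, β)`): a chain of discs `B j = ball (c j) (5ρ) ⊆ D`, `j ≤ N`,
  `c 0 = x`, `c N = β`, consecutive centres closer than `ρ`, `B 0 ⊆ ball x r₀`. -/
  have hpath : IsPathConnected D := hD.isConnected_iff_isPathConnected.1 ⟨⟨x, hx⟩, hDc⟩
  have hJ : JoinedIn D x β := hpath.joinedIn x hx β hβ
  set γ : Path x β := hJ.somePath with hγ
  have hγD : ∀ t, γ t ∈ D := hJ.somePath_mem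
  obtain ⟨δ, hδ0, hδD⟩ := (isCompact_range γ.continuous).exists_cthickening_subset_open hD
    (range_subset_iff.2 hγD)
  set ρ : ℝ := min δ r₀ / 6 with hρ
  have hmin : 0 < min δ r₀ := lt_min hδ0 hr₀
  have hρ0 : 0 < ρ := by rw [hρ]; positivity
  have hρδ : 5 * ρ ≤ δ := by rw [hρ]; linarith [min_le_left δ r₀]
  have hρr : 5 * ρ ≤ r₀ := by rw [hρ]; linarith [min_le_right δ r₀]
  have h5ρ : 0 < 5 * ρ := by positivity
  obtain ⟨η, hη0, hη⟩ := Metric.uniformContinuous_iff.1 γ.uniformContinuous_extend ρ hρ0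
  obtain ⟨k, hk⟩ := exists_nat_one_div_lt hη0
  set N : ℕ := k + 1 with hN
  have hN0 : (0 : ℝ) < N := by rw [hN]; positivity
  have hNinv : 1 / (N : ℝ) < η := by rw [hN]; push_cast; exact hk
  set c : ℕ → ℂ := fun j => γ.extend ((j : ℝ) / N) with hc
  have hcmem : ∀ j, c j ∈ range γ := fun j => by
    rw [← γ.extend_range]; exact mem_range_self _
  have hc0 : c 0 = x := by simp [hc]
  have hcN : c N = β := by
    simp only [hc]
    rw [div_self hN0.ne', Path.extend_one]
  have hstep : ∀ j : ℕ, dist (c (j + 1)) (c j) < ρ := by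
    intro j
    refine hη ?_
    rw [Real.dist_eq, Nat.cast_succ, show ((j : ℝ) + 1) / N - j / N = 1 / N from by ring,
      abs_of_pos (by positivity)]
    exact hNinv
  have hball : ∀ j, closedBall (c j) (5 * ρ) ⊆ D := fun j =>
    (closedBall_subset_closedBall hρδ).trans ((closedBall_subset_cthickening (hcmem j) δ).trans hδD)
  set B : ℕ → Set ℂ := fun j => ball (c j) (5 * ρ) with hB
  have hBD : ∀ j, B j ⊆ D := fun j => ball_subset_closedBall.trans (hball j)
  have hB0 : B 0 ⊆ ball x r₀ := by
    show ball (c 0) (5 * ρ) ⊆ ball x r₀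
    rw [hc0]; exact ball_subset_ball hρr
  -- the exponents `a j = 2^{-j}`
  set a : ℕ → ℝ := fun j => (1 / 2 : ℝ) ^ j with ha
  have ha0 : ∀ j, 0 < a j := fun j => by rw [ha]; positivity
  have haN : ∀ j, j ≤ N → a N ≤ a j := fun j hj =>
    pow_le_pow_of_le_one (by norm_num) (by norm_num) hj
  refine ⟨a N, ha0 N, pow_le_one₀ (by norm_num) (by norm_num), ?_⟩
  /- ANALYSIS. -/
  intro f ℓ e t₀ A C c₁ ht₀ hA hc₁ hfd hf0 hfg he hℓd hℓe hℓb
  -- the shift `m n = n + t₀`, `F n = f (m n)`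
  set m : ℕ → ℕ := fun n => n + t₀ with hm
  have hmt : ∀ n, t₀ ≤ m n := fun n => by simp [hm]
  have hm1 : ∀ n, (1 : ℝ) ≤ (m n : ℝ) := fun n => by
    have := hmt n; exact_mod_cast ht₀.trans this
  have hm0 : ∀ n, (0 : ℝ) < (m n : ℝ) := fun n => lt_of_lt_of_le one_pos (hm1 n)
  have hmC : ∀ n, ((m n : ℕ) : ℂ) ≠ 0 := fun n => by
    have := hm0 n; exact_mod_cast this.ne'
  set F : ℕ → ℂ → ℂ := fun n => f (m n) with hF
  -- `C ≥ 0`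
  have hC0 : 0 ≤ C := by
    have h1 := hℓb t₀ le_rfl x (mem_ball_self hr₀)
    have h2 : 0 ≤ C * Real.exp (-(c₁ * t₀)) := (norm_nonneg _).trans h1
    by_contra hc; push Not at hc; nlinarith [Real.exp_pos (-(c₁ * t₀))]
  -- the constants: `C₀ = max (C e^C) 1`, `ε' = c₁ a_N / 2`, `κ j = c₁ a_j - ε' (1 - a_j)`
  set C₀ : ℝ := max (C * Real.exp C) 1 with hC₀
  have hC₀1 : 1 ≤ C₀ := le_max_right _ _
  have hC₀0 : 0 < C₀ := lt_of_lt_of_le one_pos hC₀1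
  set ε' : ℝ := c₁ * a N / 2 with hε'
  have hε'0 : 0 < ε' := by rw [hε']; exact div_pos (mul_pos hc₁ (ha0 N)) two_pos
  set κ : ℕ → ℝ := fun j => c₁ * a j - ε' * (1 - a j) with hκ
  have hκ0 : κ 0 = c₁ := by simp [hκ, ha]
  have hκsucc : ∀ j, κ (j + 1) = (κ j - ε') / 2 := fun j => by
    simp only [hκ, ha, pow_succ]; ring
  have hκpos : ∀ j, j ≤ N → 0 < κ j := by
    intro j hj
    have h1 : a j ≤ 1 := pow_le_one₀ (by norm_num) (by norm_num)
    have h2 := haN j hj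
    have h3 : ε' * (1 - a j) ≤ ε' := by nlinarith [ha0 j]
    have h4 : κ j ≥ c₁ * a j - ε' := by simp only [hκ]; linarith
    have h5 : c₁ * a N ≤ c₁ * a j := mul_le_mul_of_nonneg_left h2 hc₁.le
    rw [hε'] at h4
    have := ha0 N
    nlinarith
  have hκN : c₁ * a N / 2 ≤ κ N := by
    have h1 : a N ≤ 1 := pow_le_one₀ (by norm_num) (by norm_num)
    have h3 : ε' * (1 - a N) ≤ ε' := by nlinarith [ha0 N]
    simp only [hκ]; rw [hε'] at h3 ⊢; linarith
  /- THE INDUCTION along the chain. -/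
  have hind : ∀ j : ℕ, j ≤ N → ∃ (g : ℕ → ℂ → ℂ) (E : ℂ → ℂ),
      (∀ n, DifferentiableOn ℂ (g n) (B j)) ∧ (∀ n, ∀ z ∈ B j, exp (g n z) = F n z) ∧
      DifferentiableOn ℂ E (B j) ∧
      TendstoLocallyUniformlyOn (fun n z => g n z / (m n : ℂ)) E atTop (B j) ∧
      ∃ T : ℕ, ∀ n, T ≤ n → ∀ z ∈ closedBall (c j) ρ,
        ‖F n z * exp (-((m n : ℂ) * E z)) - 1‖ ≤ C₀ * 2 ^ j * Real.exp (-(κ j * m n)) := by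
    intro j
    induction j with
    | zero =>
      intro _
      refine ⟨fun n => ℓ (m n), e, fun n => (hℓd (m n) (hmt n)).mono hB0,
        fun n z hz => hℓe (m n) (hmt n) z (hB0 hz), he.mono hB0, ?_, 0, fun n _ z hz => ?_⟩
      · -- uniform convergence `ℓ_m / m → e` on `B 0`
        refine TendstoUniformlyOn.tendstoLocallyUniformlyOn (Metric.tendstoUniformlyOn_iff.2 fun ε hε => ?_)
        have hlim : Tendsto (fun n : ℕ => C * Real.exp (-(c₁ * (m n : ℝ)))) atTop (𝓝 (C * 0)) := by
          refine Tendsto.const_mul C (Real.tendsto_exp_atBot.comp ?_)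
          refine tendsto_neg_atTop_atBot.comp (Tendsto.const_mul_atTop hc₁ ?_)
          exact tendsto_natCast_atTop_atTop.comp (tendsto_add_atTop_nat t₀)
        rw [mul_zero] at hlim
        filter_upwards [hlim.eventually_lt_const hε] with n hn z hz
        have h1 := hℓb (m n) (hmt n) z (hB0 hz)
        rw [dist_comm, dist_eq_norm]
        have h2 : ℓ (m n) z / (m n : ℂ) - e z = (ℓ (m n) z - (m n : ℂ) * e z) / (m n : ℂ) := by
          field_simp [hmC n]
        rw [h2, norm_div, Complex.norm_natCast]
        calc ‖ℓ (m n) z - (m n : ℂ) * e z‖ / (m n : ℝ) ≤ ‖ℓ (m n) z - (m n : ℂ) * e z‖ :=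
              div_le_self (norm_nonneg _) (hm1 n)
          _ ≤ C * Real.exp (-(c₁ * (m n : ℝ))) := h1
          _ < ε := hn
      · -- the anchor's pinning on `closedBall x ρ`
        have hzB : z ∈ B 0 := by
          show z ∈ ball (c 0) (5 * ρ)
          exact closedBall_subset_ball (by linarith) hz
        have hz' : z ∈ ball x r₀ := hB0 hzB
        set w : ℂ := ℓ (m n) z - (m n : ℂ) * e z with hw
        have h1 : ‖w‖ ≤ C * Real.exp (-(c₁ * (m n : ℝ))) := hℓb (m n) (hmt n) z hz'
        have hexp1 : Real.exp (-(c₁ * (m n : ℝ))) ≤ 1 :=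
          Real.exp_le_one_iff.2 (neg_nonpos.2 (mul_nonneg hc₁.le (Nat.cast_nonneg _)))
        have h1' : ‖w‖ ≤ C := h1.trans (by nlinarith)
        have h2 : F n z * exp (-((m n : ℂ) * e z)) = exp w := by
          rw [hw, sub_eq_add_neg, exp_add, hℓe (m n) (hmt n) z hz']
        rw [h2, pow_zero, mul_one, hκ0]
        calc ‖exp w - 1‖ ≤ ‖w‖ * Real.exp ‖w‖ := by
              simpa using Complex.norm_exp_sub_sum_le_norm_mul_exp w 1
          _ ≤ C * Real.exp (-(c₁ * (m n : ℝ))) * Real.exp C := by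
              gcongr
          _ = C * Real.exp C * Real.exp (-(c₁ * (m n : ℝ))) := by ring
          _ ≤ C₀ * Real.exp (-(c₁ * (m n : ℝ))) := by
              gcongr
              exact le_max_left _ _
    | succ j ih =>
      intro hj
      obtain ⟨g, E, hg, hge, hE, hconv, T, hT⟩ := ih (by omega)
      have hκj : 0 < κ j := hκpos j (by omega)
      set c' : ℂ := c (j + 1) with hc'
      have hc'B : c' ∈ B j := by
        show dist (c (j + 1)) (c j) < 5 * ρ
        linarith [hstep j]
      have hB1 : B (j + 1) = ball c' (5 * ρ) := rfl
      -- (1) new logarithms on `B (j+1)`, normalised at `c'`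
      have hFd : ∀ n, DifferentiableOn ℂ (F n) (ball c' (5 * ρ)) := fun n => (hfd (m n)).differentiableOn
      have hF0 : ∀ n, ∀ z ∈ ball c' (5 * ρ), F n z ≠ 0 := fun n z hz =>
        hf0 (m n) (hmt n) z (hBD (j + 1) hz)
      choose φ hφd hφc _hφ' hφe using fun n =>
        Literature.Analysis.Complex.exists_log_on_ball (hFd n) (hF0 n)
      set g' : ℕ → ℂ → ℂ := fun n z => g n c' + φ n z with hg'
      have hg'd : ∀ n, DifferentiableOn ℂ (g' n) (B (j + 1)) := fun n =>
        (differentiableOn_const _).add (hφd n)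
      have hg'e : ∀ n, ∀ z ∈ B (j + 1), exp (g' n z) = F n z := by
        intro n z hz
        show exp (g n c' + φ n z) = F n z
        rw [exp_add, hge n c' hc'B, ← hφe n z hz]
      -- (2) agreement with the old logarithms on the convex overlap
      set O : Set ℂ := B j ∩ B (j + 1) with hO
      have hOo : IsOpen O := isOpen_ball.inter isOpen_ball
      have hOc : Convex ℝ O := (convex_ball _ _).inter (convex_ball _ _)
      have hc'O : c' ∈ O := ⟨hc'B, mem_ball_self h5ρ⟩
      have hagree : ∀ n, EqOn (g n) (g' n) O := fun n =>
        eqOn_of_exp_eq_of_eq hOo hOc ((hg n).mono inter_subset_left) ((hg'd n).mono inter_subset_right)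
          (fun z hz => hge n z hz.1) (fun z hz => hg'e n z hz.2) hc'O (by simp [hg', hφc])
      -- (3) local boundedness of `g' n / m n` on `B (j+1)` (Borel–Carathéodory)
      obtain ⟨Mc, hMc⟩ : ∃ Mc : ℝ, ∀ n, ‖g n c' / (m n : ℂ)‖ ≤ Mc := by
        obtain ⟨Mc, hMc⟩ := ((hconv.tendsto_at hc'B).norm).bddAbove_range
        exact ⟨Mc, fun n => hMc ⟨n, rfl⟩⟩
      have hMc0 : 0 ≤ Mc := (norm_nonneg _).trans (hMc 0)
      set Φ : ℝ := A * (‖c'‖ + 5 * ρ) + Mc + 1 with hΦ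
      have hΦ0 : 0 < Φ := by positivity
      have hreφ : ∀ n, ∀ z ∈ ball c' (5 * ρ), (φ n z).re ≤ (m n : ℝ) * Φ := by
        intro n z hz
        have h1 : ‖F n z‖ = Real.exp ((g n c').re + (φ n z).re) := by
          rw [← hg'e n z hz]
          show ‖exp (g n c' + φ n z)‖ = _
          rw [Complex.norm_exp, add_re]
        have h2 : (g n c').re + (φ n z).re ≤ (m n : ℝ) * (A * ‖z‖) := by
          rw [← Real.exp_le_exp, ← h1]
          exact hfg (m n) (hmt n) z
        have h3 : -(g n c').re ≤ (m n : ℝ) * Mc := by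
          calc -(g n c').re ≤ ‖g n c'‖ := by
                have := abs_re_le_norm (g n c'); have := neg_abs_le (g n c').re; linarith
            _ = ‖g n c' / (m n : ℂ)‖ * (m n : ℝ) := by
                rw [norm_div, Complex.norm_natCast, div_mul_cancel₀ _ (hm0 n).ne']
            _ ≤ Mc * (m n : ℝ) := mul_le_mul_of_nonneg_right (hMc n) (hm0 n).le
            _ = (m n : ℝ) * Mc := mul_comm _ _
        have h4 : ‖z‖ ≤ ‖c'‖ + 5 * ρ := by
          have := norm_le_norm_add_norm_sub' z c'
          rw [← dist_eq_norm] at this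
          have hz' : dist z c' < 5 * ρ := hz
          linarith
        have h5 : (m n : ℝ) * (A * ‖z‖) ≤ (m n : ℝ) * (A * (‖c'‖ + 5 * ρ)) :=
          mul_le_mul_of_nonneg_left (mul_le_mul_of_nonneg_left h4 hA) (hm0 n).le
        have h6 : 0 ≤ (m n : ℝ) := (hm0 n).le
        rw [hΦ]
        nlinarith
      have hbdd : ∀ a' ∈ B (j + 1), ∃ M : ℝ, ∃ r > 0, ∀ n, ∀ z ∈ ball a' r ∩ B (j + 1),
          ‖g' n z / (m n : ℂ)‖ ≤ M := by
        intro a' ha'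
        have hd : dist a' c' < 5 * ρ := ha'
        refine ⟨Mc + 4 * Φ * (5 * ρ) / (5 * ρ - dist a' c'), (5 * ρ - dist a' c') / 2, by linarith,
          fun n z hz => ?_⟩
        have key := norm_le_of_re_le_local h5ρ (by positivity : 0 < (m n : ℝ) * Φ) (hφd n) (hφc n)
          (hreφ n) ha' hz.1
        show ‖(g n c' + φ n z) / (m n : ℂ)‖ ≤ _
        rw [add_div]
        refine (norm_add_le _ _).trans (add_le_add (hMc n) ?_)
        rw [norm_div, Complex.norm_natCast, div_le_iff₀ (hm0 n)]
        refine key.trans (le_of_eq ?_)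
        have : (5 * ρ - dist a' c') ≠ 0 := by linarith
        field_simp
      -- (4) Vitali on `B (j+1)`: the normalised logarithms converge to a holomorphic rate `E'`
      have hfreq : ∃ᶠ z in 𝓝[≠] c', ∃ w : ℂ, Tendsto (fun n => g' n z / (m n : ℂ)) atTop (𝓝 w) := by
        have hev : ∀ᶠ z in 𝓝 c', ∃ w : ℂ, Tendsto (fun n => g' n z / (m n : ℂ)) atTop (𝓝 w) := by
          filter_upwards [hOo.mem_nhds hc'O] with z hz
          exact ⟨E z, (hconv.tendsto_at hz.1).congr fun n => by simp only [hagree n hz]⟩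
        exact (hev.filter_mono nhdsWithin_le_nhds).frequently
      obtain ⟨E', hE'd, hconv'⟩ :=
        Literature.Analysis.Complex.exists_tendstoLocallyUniformlyOn_of_frequently_tendsto (U := B (j + 1))
          isOpen_ball (convex_ball _ _).isPreconnected (F := fun n z => g' n z / (m n : ℂ))
          (fun n => (hg'd n).div_const _) hbdd (mem_ball_self h5ρ) hfreq
      have hEE' : ∀ z ∈ O, E' z = E z := fun z hz =>
        tendsto_nhds_unique (hconv'.tendsto_at hz.2)
          ((hconv.tendsto_at hz.1).congr fun n => by simp only [hagree n hz])
      -- (5) the sub-exponential bound on `closedBall (c j) (4ρ)` from uniform convergence `g n / m n → E`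
      have hKsub : closedBall (c j) (4 * ρ) ⊆ B j := closedBall_subset_ball (by linarith)
      have hunifK := (tendstoLocallyUniformlyOn_iff_forall_isCompact isOpen_ball).1 hconv _ hKsub
        (isCompact_closedBall _ _)
      obtain ⟨T', hT'⟩ := eventually_atTop.1 ((Metric.tendstoUniformlyOn_iff.1 hunifK) ε' hε'0)
      have hKbound : ∀ n, T' ≤ n → ∀ z ∈ closedBall (c j) (4 * ρ),
          ‖F n z * exp (-((m n : ℂ) * E z)) - 1‖ ≤ Real.exp (ε' * m n) + 1 := by
        intro n hn z hz
        have h1 := hT' n hn z hz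
        rw [dist_comm, dist_eq_norm] at h1
        have hzB : z ∈ B j := hKsub hz
        have h2 : F n z * exp (-((m n : ℂ) * E z)) = exp (g n z - (m n : ℂ) * E z) := by
          rw [sub_eq_add_neg, exp_add, hge n z hzB]
        rw [h2]
        have h3 : g n z - (m n : ℂ) * E z = (m n : ℂ) * (g n z / (m n : ℂ) - E z) := by
          field_simp [hmC n]
        calc ‖exp (g n z - (m n : ℂ) * E z) - 1‖
            ≤ ‖exp (g n z - (m n : ℂ) * E z)‖ + ‖(1 : ℂ)‖ := norm_sub_le _ _
          _ = Real.exp ((g n z - (m n : ℂ) * E z).re) + 1 := by rw [Complex.norm_exp, norm_one]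
          _ ≤ Real.exp (ε' * m n) + 1 := by
              gcongr
              calc (g n z - (m n : ℂ) * E z).re ≤ ‖g n z - (m n : ℂ) * E z‖ := re_le_norm _
                _ = (m n : ℝ) * ‖g n z / (m n : ℂ) - E z‖ := by
                    rw [h3, norm_mul, Complex.norm_natCast]
                _ ≤ (m n : ℝ) * ε' := mul_le_mul_of_nonneg_left h1.le (hm0 n).le
                _ = ε' * m n := mul_comm _ _
      -- (6) Hadamard three circles at centre `c j`
      have hC2 : 1 ≤ C₀ * 2 ^ j := one_le_mul_of_one_le_of_one_le hC₀1 (one_le_pow₀ one_le_two)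
      have hsmall : ∀ n, max T T' ≤ n → ∀ z ∈ closedBall (c j) (2 * ρ),
          ‖F n z * exp (-((m n : ℂ) * E z)) - 1‖ ≤ C₀ * 2 ^ (j + 1) * Real.exp (-(κ (j + 1) * m n)) := by
        intro n hn z hz
        obtain ⟨εn, hεn⟩ : ∃ εn : ℝ, εn = C₀ * 2 ^ j * Real.exp (-(κ j * m n)) := ⟨_, rfl⟩
        obtain ⟨Kn, hKn⟩ : ∃ Kn : ℝ, Kn = C₀ * 2 ^ j * (Real.exp (ε' * m n) + 1) := ⟨_, rfl⟩
        have hP0 : 0 < C₀ * 2 ^ j := lt_of_lt_of_le one_pos hC2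
        have hεn0 : 0 < εn := by rw [hεn]; exact mul_pos hP0 (Real.exp_pos _)
        have hexp1 : Real.exp (-(κ j * m n)) ≤ 1 :=
          Real.exp_le_one_iff.2 (neg_nonpos.2 (mul_nonneg hκj.le (Nat.cast_nonneg _)))
        have hεK : εn ≤ Kn := by
          rw [hεn, hKn]
          apply mul_le_mul_of_nonneg_left _ hP0.le
          linarith [Real.exp_pos (ε' * m n)]
        have hh : DifferentiableOn ℂ (fun z => F n z * exp (-((m n : ℂ) * E z)) - 1) (B j) :=
          ((hfd (m n)).differentiableOn.mul ((differentiableOn_const _).mul hE).neg.cexp).sub_const 1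
        have hKw : ∀ w ∈ closedBall (c j) (4 * ρ), ‖F n w * exp (-((m n : ℂ) * E w)) - 1‖ ≤ Kn := by
          intro w hw
          rw [hKn]
          exact (hKbound n ((le_max_right _ _).trans hn) w hw).trans
            (le_mul_of_one_le_left (by positivity) hC2)
        have hεw : ∀ w ∈ closedBall (c j) ρ, ‖F n w * exp (-((m n : ℂ) * E w)) - 1‖ ≤ εn := by
          intro w hw
          rw [hεn]
          exact hT n ((le_max_left _ _).trans hn) w hw
        have key := Summit.QuantumFields.YangMills.Theorems.ComplexCouplingChannel.norm_le_sqrt_of_three_circles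
          isOpen_ball hh hρ0 hKsub hεn0 hεK hKw hεw hz
        refine key.trans ?_
        have hR0 : 0 ≤ C₀ * 2 ^ (j + 1) * Real.exp (-(κ (j + 1) * m n)) :=
          mul_nonneg (mul_nonneg hC₀0.le (pow_nonneg zero_le_two _)) (Real.exp_pos _).le
        rw [← Real.mul_rpow hεn0.le (hεn0.le.trans hεK), ← Real.sqrt_eq_rpow, ← Real.sqrt_sq hR0]
        apply Real.sqrt_le_sqrt
        -- `εn Kn ≤ (C₀ 2^{j+1} e^{-κ_{j+1} m})²`
        have hsq : (C₀ * 2 ^ (j + 1) * Real.exp (-(κ (j + 1) * m n))) ^ 2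
            = (C₀ * 2 ^ j) ^ 2 * Real.exp (-(κ j * m n)) * (4 * Real.exp (ε' * m n)) := by
          have he : Real.exp (-(κ (j + 1) * m n)) ^ 2 = Real.exp (-(κ j * m n)) * Real.exp (ε' * m n) := by
            rw [sq, ← Real.exp_add, ← Real.exp_add, hκsucc]
            ring_nf
          rw [mul_pow, mul_pow, he]
          ring
        have h1 : Real.exp (ε' * m n) + 1 ≤ 4 * Real.exp (ε' * m n) := by
          linarith [Real.one_le_exp (le_of_lt (mul_pos hε'0 (hm0 n)))]
        have h2 : 0 ≤ (C₀ * 2 ^ j) ^ 2 * Real.exp (-(κ j * m n)) :=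
          mul_nonneg (sq_nonneg _) (Real.exp_pos _).le
        rw [hsq, hεn, hKn]
        calc C₀ * 2 ^ j * Real.exp (-(κ j * m n)) * (C₀ * 2 ^ j * (Real.exp (ε' * m n) + 1))
            = (C₀ * 2 ^ j) ^ 2 * Real.exp (-(κ j * m n)) * (Real.exp (ε' * m n) + 1) := by ring
          _ ≤ (C₀ * 2 ^ j) ^ 2 * Real.exp (-(κ j * m n)) * (4 * Real.exp (ε' * m n)) :=
              mul_le_mul_of_nonneg_left h1 h2
      -- (7) assemble `P (j+1)`
      refine ⟨g', E', hg'd, hg'e, hE'd, hconv', max T T', fun n hn z hz => ?_⟩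
      have hz1 : dist z c' ≤ ρ := hz
      have hzO : z ∈ O := by
        refine ⟨?_, ?_⟩
        · show dist z (c j) < 5 * ρ
          linarith [dist_triangle z c' (c j), hstep j]
        · show dist z c' < 5 * ρ
          linarith
      have hz2 : z ∈ closedBall (c j) (2 * ρ) := by
        show dist z (c j) ≤ 2 * ρ
        linarith [dist_triangle z c' (c j), hstep j]
      rw [hEE' z hzO]
      exact hsmall n hn z hz2
  /- CONCLUSION at `β = c N`. -/
  obtain ⟨g, E, -, -, -, -, T, hT⟩ := hind N le_rfl
  refine ⟨E β, C₀ * 2 ^ N, T + t₀, fun t ht => ?_⟩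
  obtain ⟨n, rfl⟩ : ∃ n, t = n + t₀ := ⟨t - t₀, by omega⟩
  have hβmem : β ∈ closedBall (c N) ρ := by
    rw [hcN]; exact mem_closedBall_self hρ0.le
  have h1 := hT n (by omega) β hβmem
  refine h1.trans (mul_le_mul_of_nonneg_left (Real.exp_le_exp.2 ?_) (by positivity))
  show -(κ N * ((n + t₀ : ℕ) : ℝ)) ≤ -(c₁ * a N / 2 * ((n + t₀ : ℕ) : ℝ))
  have := Nat.cast_nonneg (α := ℝ) (n + t₀)
  nlinarith [hκN]


end Summit.QuantumFields.YangMills.Theorems.TubeZeroFreeChannel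

end
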